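import Summits.NavierStokesRegularity.OSWSelfSimilar.SheetREnergyClassBilinear
import Summits.NavierStokesRegularity.OSWSelfSimilar.SheetRWeakZeroParity
import Literature.Analysis.Fourier.HilbertTransformLineWeightedL2ZeroMass
import HarnessLib

/-!
# SHEET-ℝ frame, EVEN ZERO-MASS class `E⁺₀`: weighted isometry, the COVARIANT velocity bound, and the trilinear bound for the
# even quadratic part — the calculus behind the even Lipschitz constant `L⁺_lip` (DESIGN-Z3-SR-SPEC-EVEN (D3), PREREG P4 (iv))

HONEST FRAMING (cell ns-blowup GROUP B / zone Z3, case Z3-SR-SPEC EVEN half (SPEC-EVEN-R1); 1-D MODEL certificate frame (viscous gCLM/OSW sheet on the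
line); not Euler/NS; «violates: none — MODEL»). Nothing here asserts that a profile exists; no number of any certificate moves.

The even certificate (`CertificateViscousSheetRSpectrumEven`, p526204) works in `E⁺₀` = even ZERO-MASS `H¹_w`, `w = L² + ξ²`, with the
translation-COVARIANT perturbation velocity `𝒰⁺δ(ξ) := ∫_{−∞}^ξ Hδ` (DESIGN (D2)), and carries the literal `L⁺_lip = 2.01937` (DESIGN (D3):
`8√2/L + 4a(1+√2)(π/4L)^{1/2}` at `L = 8`, `a = 1/5`) for the Lipschitz constant of `Ω ↦ DG⁺(Ω)` — PAPER item P4 (iv).  The odd-class toolkit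
(`SheetREnergyClass`, `SheetREnergyClassBilinear`: `‖Hu‖_w = ‖u‖_w`, `|𝒰u| ≤ (π/4L)^{1/2}‖u‖_w`, `sup|v| ≤ √2‖v‖_E/L`, the trilinear bound
`abs_pairing_quadratic_le`) covers the term `Q(u, δ) = a·𝒰u·δ′ − Hu·δ` (`u` odd = a difference of profiles, `δ` arbitrary).  THIS FILE supplies the
EVEN companion for the other term `Q⁺(δ, u) = a·𝒰⁺δ·u′ − Hδ·u` (`δ ∈ E⁺₀`):
* `weightedSq_hilbertTransform_of_primitive_zeroMass` — `‖Hδ‖_w = ‖δ‖_w` on the whole ZERO-MASS `H¹_w` class (parity-free; the Literature lemma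
  `integral_weight_mul_hilbertTransform_sq_eq_of_integral_zero`, King eq. (19.270), p.v. hypothesis discharged by `integrableOn_symmIntegrand_of_primitive`);
* `abs_setIntegral_Iic_le_of_odd` — for an ODD `g` with `∫wg² < ∞`: `|∫_{(−∞,ξ]} g| ≤ (π/(4L))^{1/2}‖g‖_w` at EVERY `ξ` (half-line Cauchy–Schwarz +
  halving by symmetry of `g²` + `∫_ℝ g = 0`, `SheetRWeakZeroParity.integral_eq_zero_of_odd`);
* `abs_covariantVelocity_le` — for EVEN zero-mass `δ` in the class: `|𝒰⁺δ(ξ)| = |∫_{(−∞,ξ]} Hδ| ≤ (π/(4L))^{1/2}‖δ‖_w` — the SAME constant as the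
  odd pinned velocity (DESIGN (D3) registered the cruder `(π/2L)^{1/2}`, √2 larger; both are upper bounds, the registered `L⁺_lip` stays valid a fortiori);
* `abs_pairing_quadratic_even_le` — `|∫ w·(a·𝒰⁺δ·u₁ − Hδ·u)·φ| ≤ (2|a|(π/(4L))^{1/2} + 2√2/L)·‖δ‖_E·‖u‖_E·‖φ‖_w` for `δ` even zero-mass, `u`
  any `H¹_w` primitive, `φ ∈ L²_w`; with `abs_pairing_quadratic_le` for the other term and `‖φ‖_w ≤ 2‖φ‖_E` this gives the function-level even
  Lipschitz bound with constant `2·2·(2√2/L + 2|a|(π/(4L))^{1/2}) = 8√2/L + 8|a|(π/4L)^{1/2}` (`= 1.9156` at the certificate's `L = 8`, `a = 1/5`,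
  BELOW the registered `L⁺_lip = 2.01937` — `abs_pairing_linearisation_diff_even_le` and the numeric comparison `evenLipschitzConstant_le_LlipE`).
Pure calculus; no definition, no named fact.  WHAT THIS IS NOT: not NS; not the Hilbert-space packaging of `E⁺₀` (the operator-norm sentence
`‖DG⁺(Ω₁) − DG⁺(Ω₂)‖_{E⁺₀→X*} ≤ L⁺_lip‖Ω₁ − Ω₂‖_E` follows from these bounds once `E⁺₀`, `X*` are instantiated — not done here).
-/

noncomputable section

namespace Summit.NavierStokesRegularity.OSWSelfSimilar
namespace SheetREvenEnergyClass

open _root_.MeasureTheory _root_.Set _root_.Filter _root_.Function Literature.Analysis.Fourier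
  SheetRWeakProfilePV SheetRWeakToStrong SheetREnergyClass SheetRWeightedEmbeddings
open scoped Real Topology

/-! ### §1 Weighted isometry on the zero-mass class (parity-free) -/

/-- **`‖Hδ‖_w = ‖δ‖_w` on the whole ZERO-MASS weighted class.** For an `H¹`-type `δ = δ(0) + ∫₀δ₁` (`δ₁` a.e.-strongly measurable) with
`∫(L²+y²)δ² < ∞`, `∫(L²+y²)δ₁² < ∞` (`L > 0`) and ZERO MASS `∫δ = 0`: `Hδ` is a.e.-strongly measurable, `(L²+y²)(Hδ)² ∈ L¹` and
`∫(L²+y²)(Hδ)² = ∫(L²+y²)δ²`.  No parity hypothesis (King eq. (19.270) via `integral_weight_mul_hilbertTransform_sq_eq_of_integral_zero`; the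
p.v. hypothesis is discharged by `integrableOn_symmIntegrand_of_primitive`). MODEL frame bookkeeping. [folklore] -/
theorem weightedSq_hilbertTransform_of_primitive_zeroMass {δ δ₁ : ℝ → ℝ} {L : ℝ} (hL : 0 < L)
    (hδ : ∀ x, δ x = δ 0 + ∫ s in (0 : ℝ)..x, δ₁ s) (hδ₁m : AEStronglyMeasurable δ₁ volume)
    (h0 : Integrable fun y => (L ^ 2 + y ^ 2) * δ y ^ 2) (h1 : Integrable fun y => (L ^ 2 + y ^ 2) * δ₁ y ^ 2)
    (hm : ∫ y, δ y = 0) :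
    AEStronglyMeasurable (hilbertTransform δ) volume ∧
      Integrable (fun y => (L ^ 2 + y ^ 2) * hilbertTransform δ y ^ 2) ∧
      ∫ y, (L ^ 2 + y ^ 2) * hilbertTransform δ y ^ 2 = ∫ y, (L ^ 2 + y ^ 2) * δ y ^ 2 := by
  obtain ⟨hc, hδ₁2, hδ2, hδi, -⟩ := basic_of_primitive hL hδ hδ₁m h0 h1
  have hint := integrableOn_symmIntegrand_of_primitive hδ hδ₁2 hδi
  obtain ⟨hw, hiso⟩ := weightedSq_hilbertTransform_of_integral_zero hL hδi hm hc.aestronglyMeasurable h0 hint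
  exact ⟨(memLp_two_hilbertTransform hδi hδ2 (ae_of_all _ hint)).1, hw, hiso⟩

/-! ### §2 Half-line bounds for ODD weighted-`L²` functions and the covariant velocity -/

/-- For an ODD `g`, `∫_{y>0}(L²+y²)g² = ½∫(L²+y²)g²` (`g²` is even). [folklore] -/
theorem setIntegral_Ioi_eq_half_of_odd {L : ℝ} {g : ℝ → ℝ} (hodd : ∀ y, g (-y) = -g y) :
    ∫ y in Ioi (0 : ℝ), (L ^ 2 + y ^ 2) * g y ^ 2 = 1 / 2 * ∫ y, (L ^ 2 + y ^ 2) * g y ^ 2 := by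
  have h := setIntegral_Ioi_eq_half_of_even (L := L) (g := fun y => |g y|) (fun y => by simp only [hodd, abs_neg])
  simp only [sq_abs] at h
  exact h

/-- **Half-line bound for ODD functions**: `g` odd, a.e.-strongly measurable, `∫(L²+y²)g² < ∞` (`L > 0`), `S ⊆ (0,∞)` ⇒
`|∫_S g| ≤ (π/(4L))^{1/2}·(∫(L²+y²)g²)^{1/2}`. [folklore] -/
theorem abs_setIntegral_le_of_weighted_sq_odd {L : ℝ} (hL : 0 < L) {g : ℝ → ℝ} (hgm : AEStronglyMeasurable g volume)
    (h0 : Integrable (fun y => (L ^ 2 + y ^ 2) * g y ^ 2)) (hodd : ∀ y, g (-y) = -g y)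
    {S : Set ℝ} (hS0 : S ⊆ Ioi 0) :
    |∫ y in S, g y| ≤ Real.sqrt (π / (4 * L)) * Real.sqrt (∫ y, (L ^ 2 + y ^ 2) * g y ^ 2) := by
  have h := abs_setIntegral_le_of_weighted_sq hL hgm h0 hS0
  rw [setIntegral_Ioi_eq_half_of_odd hodd] at h
  have hI : 0 ≤ ∫ y, (L ^ 2 + y ^ 2) * g y ^ 2 := integral_nonneg fun y => by positivity
  calc |∫ y in S, g y| ≤ Real.sqrt (π / (2 * L)) * Real.sqrt (1 / 2 * ∫ y, (L ^ 2 + y ^ 2) * g y ^ 2) := h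
    _ = Real.sqrt (π / (4 * L)) * Real.sqrt (∫ y, (L ^ 2 + y ^ 2) * g y ^ 2) := by
        rw [Real.sqrt_mul' _ hI, ← mul_assoc, ← Real.sqrt_mul (by positivity)]
        congr 2
        field_simp
        ring

/-- **Left half-line bound at EVERY point for ODD functions**: `g` odd, a.e.-strongly measurable, `∫(L²+y²)g² < ∞` (`L > 0`) ⇒
`|∫_{(−∞,ξ]} g| ≤ (π/(4L))^{1/2}·(∫(L²+y²)g²)^{1/2}` for every `ξ` (reflection `∫_{(−∞,ξ]} g = −∫_{(−ξ,∞)} g` for `ξ ≤ 0`;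
`∫_{(−∞,ξ]} g = −∫_{(ξ,∞)} g` from `∫_ℝ g = 0` for `ξ > 0`). [folklore] -/
theorem abs_setIntegral_Iic_le_of_odd {L : ℝ} (hL : 0 < L) {g : ℝ → ℝ} (hgm : AEStronglyMeasurable g volume)
    (h0 : Integrable (fun y => (L ^ 2 + y ^ 2) * g y ^ 2)) (hodd : ∀ y, g (-y) = -g y) (ξ : ℝ) :
    |∫ y in Iic ξ, g y| ≤ Real.sqrt (π / (4 * L)) * Real.sqrt (∫ y, (L ^ 2 + y ^ 2) * g y ^ 2) := by
  have hgi : Integrable g := integrable_of_weighted_sq hL hgm h0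
  rcases le_or_gt ξ 0 with hξ | hξ
  · -- reflect: `∫_{Iic ξ} g = −∫_{Ioi (−ξ)} g`
    have e : ∫ y in Iic ξ, g y = -∫ y in Ioi (-ξ), g y := by
      rw [← integral_comp_neg_Iic ξ g, ← integral_neg]
      exact setIntegral_congr_fun measurableSet_Iic fun y _ => by rw [hodd, neg_neg]
    rw [e, abs_neg]
    exact abs_setIntegral_le_of_weighted_sq_odd hL hgm h0 hodd (Ioi_subset_Ioi (by linarith))
  · -- complement: `∫_{Iic ξ} g = ∫ g − ∫_{Ioi ξ} g = −∫_{Ioi ξ} g`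
    have e : ∫ y in Iic ξ, g y = -∫ y in Ioi ξ, g y := by
      have h := intervalIntegral.integral_Iic_add_Ioi (f := g) (μ := volume) (b := ξ) hgi.integrableOn hgi.integrableOn
      rw [SheetRWeakZeroParity.integral_eq_zero_of_odd hodd] at h
      linarith
    rw [e, abs_neg]
    exact abs_setIntegral_le_of_weighted_sq_odd hL hgm h0 hodd (Ioi_subset_Ioi hξ.le)

/-- **THE COVARIANT VELOCITY BOUND.** For an EVEN `H¹`-type `δ = δ(0) + ∫₀δ₁` with `∫(L²+y²)δ² < ∞`, `∫(L²+y²)δ₁² < ∞` (`L > 0`) and zero mass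
`∫δ = 0` (`δ ∈ E⁺₀`): the translation-covariant velocity `𝒰⁺δ(ξ) = ∫_{(−∞,ξ]} Hδ` satisfies `|𝒰⁺δ(ξ)| ≤ (π/(4L))^{1/2}·(∫(L²+y²)δ²)^{1/2}`
at EVERY `ξ` (`Hδ` is odd, `‖Hδ‖_w = ‖δ‖_w`).  Same constant as the odd pinned velocity `SheetREnergyClass.abs_velocity_le_of_primitive`;
DESIGN (D3)'s registered `(π/2L)^{1/2}` is the cruder bound. MODEL frame bookkeeping. [folklore] -/
theorem abs_covariantVelocity_le {δ δ₁ : ℝ → ℝ} {L : ℝ} (hL : 0 < L)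
    (hδ : ∀ x, δ x = δ 0 + ∫ s in (0 : ℝ)..x, δ₁ s) (heven : ∀ y, δ (-y) = δ y) (hδ₁m : AEStronglyMeasurable δ₁ volume)
    (h0 : Integrable fun y => (L ^ 2 + y ^ 2) * δ y ^ 2) (h1 : Integrable fun y => (L ^ 2 + y ^ 2) * δ₁ y ^ 2)
    (hm : ∫ y, δ y = 0) (ξ : ℝ) :
    |∫ s in Iic ξ, hilbertTransform δ s| ≤ Real.sqrt (π / (4 * L)) * Real.sqrt (∫ y, (L ^ 2 + y ^ 2) * δ y ^ 2) := by
  obtain ⟨hHm, hwH, hiso⟩ := weightedSq_hilbertTransform_of_primitive_zeroMass hL hδ hδ₁m h0 h1 hm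
  rw [← hiso]
  exact abs_setIntegral_Iic_le_of_odd hL hHm hwH (fun y => hilbertTransform_neg_arg_of_even heven y) ξ

/-- The covariant velocity is the pinned one plus a constant: `∫_{(−∞,ξ]} Hδ = ∫_{(−∞,0]} Hδ + ∫₀^ξ Hδ`; hence it is continuous.
(`Hδ ∈ L¹` from `‖Hδ‖_w < ∞`.) [folklore] -/
theorem covariantVelocity_eq_const_add {δ δ₁ : ℝ → ℝ} {L : ℝ} (hL : 0 < L)
    (hδ : ∀ x, δ x = δ 0 + ∫ s in (0 : ℝ)..x, δ₁ s) (hδ₁m : AEStronglyMeasurable δ₁ volume)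
    (h0 : Integrable fun y => (L ^ 2 + y ^ 2) * δ y ^ 2) (h1 : Integrable fun y => (L ^ 2 + y ^ 2) * δ₁ y ^ 2)
    (hm : ∫ y, δ y = 0) :
    (∀ ξ, ∫ s in Iic ξ, hilbertTransform δ s = (∫ s in Iic (0 : ℝ), hilbertTransform δ s) + ∫ s in (0 : ℝ)..ξ, hilbertTransform δ s) ∧
      Continuous fun ξ => ∫ s in Iic ξ, hilbertTransform δ s := by
  obtain ⟨hHm, hwH, -⟩ := weightedSq_hilbertTransform_of_primitive_zeroMass hL hδ hδ₁m h0 h1 hm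
  obtain ⟨-, hδ₁2, hδ2, hδi, -⟩ := basic_of_primitive hL hδ hδ₁m h0 h1
  have hHi : Integrable (hilbertTransform δ) := integrable_of_weighted_sq hL hHm hwH
  have hsplit : ∀ ξ, ∫ s in Iic ξ, hilbertTransform δ s =
      (∫ s in Iic (0 : ℝ), hilbertTransform δ s) + ∫ s in (0 : ℝ)..ξ, hilbertTransform δ s := fun ξ => by
    have h := intervalIntegral.integral_Iic_sub_Iic (f := hilbertTransform δ) (μ := volume) (a := 0) (b := ξ)
      hHi.integrableOn hHi.integrableOn
    linarith
  refine ⟨hsplit, ?_⟩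
  have e : (fun ξ => ∫ s in Iic ξ, hilbertTransform δ s) =
      fun ξ => (∫ s in Iic (0 : ℝ), hilbertTransform δ s) + ∫ s in (0 : ℝ)..ξ, hilbertTransform δ s := funext hsplit
  rw [e]
  exact continuous_const.add (continuous_velocity_of_primitive hδ hδ₁2 hδi hδ2)

/-! ### §3 The trilinear bound for the even quadratic part -/

/-- **The even trilinear bound.** For an EVEN zero-mass `H¹`-type `δ = δ(0) + ∫₀δ₁`, an `H¹`-type `u = u(0) + ∫₀u₁` (weighted `L²` data,
`w = L² + ξ²`, `L > 0`) and `φ` with `∫wφ² < ∞`: the pairing `∫ w·(a·𝒰⁺δ·u₁ − Hδ·u)·φ` (`𝒰⁺δ = ∫_{(−∞,ξ]} Hδ`, the covariant velocity) is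
absolutely convergent and `|∫ w·(a·𝒰⁺δ·u₁ − Hδ·u)·φ| ≤ (2|a|(π/(4L))^{1/2} + 2√2/L)·‖δ‖_E·‖u‖_E·‖φ‖_w` — the same constant as the odd
`SheetREnergyClass.abs_pairing_quadratic_le`. MODEL frame bookkeeping. [folklore] -/
theorem abs_pairing_quadratic_even_le {δ δ₁ u u₁ φ : ℝ → ℝ} {L a : ℝ} (hL : 0 < L)
    (hδ : ∀ x, δ x = δ 0 + ∫ s in (0 : ℝ)..x, δ₁ s) (heven : ∀ y, δ (-y) = δ y) (hδ₁m : AEStronglyMeasurable δ₁ volume)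
    (hwδ : Integrable fun y => (L ^ 2 + y ^ 2) * δ y ^ 2) (hwδ₁ : Integrable fun y => (L ^ 2 + y ^ 2) * δ₁ y ^ 2)
    (hm : ∫ y, δ y = 0)
    (hu : ∀ x, u x = u 0 + ∫ s in (0 : ℝ)..x, u₁ s) (hu₁m : AEStronglyMeasurable u₁ volume)
    (hwu : Integrable fun y => (L ^ 2 + y ^ 2) * u y ^ 2) (hwu₁ : Integrable fun y => (L ^ 2 + y ^ 2) * u₁ y ^ 2)
    (hφm : AEStronglyMeasurable φ volume) (hwφ : Integrable fun y => (L ^ 2 + y ^ 2) * φ y ^ 2) :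
    Integrable (fun y => (L ^ 2 + y ^ 2) *
        ((a * (∫ s in Iic y, hilbertTransform δ s) * u₁ y - hilbertTransform δ y * u y) * φ y)) ∧
      |∫ y, (L ^ 2 + y ^ 2) * ((a * (∫ s in Iic y, hilbertTransform δ s) * u₁ y - hilbertTransform δ y * u y) * φ y)|
        ≤ (2 * |a| * Real.sqrt (π / (4 * L)) + 2 * Real.sqrt 2 / L)
          * Real.sqrt (∫ y, (L ^ 2 + y ^ 2) * (δ₁ y ^ 2 + 1 / 4 * δ y ^ 2))
          * Real.sqrt (∫ y, (L ^ 2 + y ^ 2) * (u₁ y ^ 2 + 1 / 4 * u y ^ 2))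
          * Real.sqrt (∫ y, (L ^ 2 + y ^ 2) * φ y ^ 2) := by
  set H : ℝ → ℝ := hilbertTransform δ with hH
  set V : ℝ → ℝ := fun y => ∫ s in Iic y, H s with hVdef
  -- facts on the classes
  obtain ⟨huc, _, _, _, -⟩ := basic_of_primitive hL hu hu₁m hwu hwu₁
  obtain ⟨hHm, hwH, hiso⟩ := weightedSq_hilbertTransform_of_primitive_zeroMass hL hδ hδ₁m hwδ hwδ₁ hm
  obtain ⟨-, hVc⟩ := covariantVelocity_eq_const_add hL hδ hδ₁m hwδ hwδ₁ hm
  set sD : ℝ := Real.sqrt (∫ y, (L ^ 2 + y ^ 2) * δ y ^ 2) with hsD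
  set sU1 : ℝ := Real.sqrt (∫ y, (L ^ 2 + y ^ 2) * u₁ y ^ 2) with hsU1
  set sED : ℝ := Real.sqrt (∫ y, (L ^ 2 + y ^ 2) * (δ₁ y ^ 2 + 1 / 4 * δ y ^ 2)) with hsED
  set sEU : ℝ := Real.sqrt (∫ y, (L ^ 2 + y ^ 2) * (u₁ y ^ 2 + 1 / 4 * u y ^ 2)) with hsEU
  set sW : ℝ := Real.sqrt (∫ y, (L ^ 2 + y ^ 2) * φ y ^ 2) with hsW
  set P : ℝ := Real.sqrt (π / (4 * L)) with hP
  have hsD0 : 0 ≤ sD := Real.sqrt_nonneg _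
  have hsW0 : 0 ≤ sW := Real.sqrt_nonneg _
  have hsED0 : 0 ≤ sED := Real.sqrt_nonneg _
  have hsEU0 : 0 ≤ sEU := Real.sqrt_nonneg _
  have hP0 : 0 ≤ P := Real.sqrt_nonneg _
  -- sup bounds: |V| ≤ P·sD, |u| ≤ (√2/L)·sEU
  have hV : ∀ y, |V y| ≤ P * sD := fun y => abs_covariantVelocity_le hL hδ heven hδ₁m hwδ hwδ₁ hm y
  have hU : ∀ y, |u y| ≤ Real.sqrt 2 / L * sEU := fun y =>
    abs_le_sqrt_two_div_mul_energy_of_primitive hL hu hu₁m hwu hwu₁ y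
  have hCV0 : 0 ≤ P * sD := mul_nonneg hP0 hsD0
  have hCU0 : 0 ≤ Real.sqrt 2 / L * sEU := by positivity
  -- weighted Cauchy–Schwarz instances
  obtain ⟨hi1, hcs1⟩ := integral_weight_abs_mul_le (L := L) hu₁m hφm hwu₁ hwφ
  obtain ⟨hi2, hcs2⟩ := integral_weight_abs_mul_le (L := L) hHm hφm hwH hwφ
  have hsH : Real.sqrt (∫ y, (L ^ 2 + y ^ 2) * H y ^ 2) = sD := by rw [hsD, ← hiso]
  -- energy comparisons
  obtain ⟨hsD_le, -⟩ := sqrt_weightedSq_le_energy hwδ hwδ₁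
  obtain ⟨-, hsU1_le⟩ := sqrt_weightedSq_le_energy hwu hwu₁
  -- term 1: A y = w·(a·V·u₁·φ)
  have hwm : AEStronglyMeasurable (fun y : ℝ => L ^ 2 + y ^ 2) volume := by fun_prop
  have hAm : AEStronglyMeasurable (fun y => (L ^ 2 + y ^ 2) * (a * V y * u₁ y * φ y)) volume :=
    hwm.mul (((hVc.aestronglyMeasurable.const_mul a).mul hu₁m).mul hφm)
  have hApt : ∀ y, |(L ^ 2 + y ^ 2) * (a * V y * u₁ y * φ y)| ≤ |a| * (P * sD) * ((L ^ 2 + y ^ 2) * |u₁ y * φ y|) := by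
    intro y
    have hw : 0 ≤ L ^ 2 + y ^ 2 := by positivity
    rw [abs_mul, abs_of_nonneg hw, show a * V y * u₁ y * φ y = (a * V y) * (u₁ y * φ y) by ring, abs_mul, abs_mul]
    have h1 : |a| * |V y| ≤ |a| * (P * sD) := mul_le_mul_of_nonneg_left (hV y) (abs_nonneg a)
    have h2 : 0 ≤ |u₁ y * φ y| := abs_nonneg _
    nlinarith [mul_le_mul_of_nonneg_right h1 (mul_nonneg hw h2)]
  have hAi : Integrable (fun y => (L ^ 2 + y ^ 2) * (a * V y * u₁ y * φ y)) :=
    (hi1.const_mul (|a| * (P * sD))).mono' hAm (Eventually.of_forall fun y => by rw [Real.norm_eq_abs]; exact hApt y)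
  have hAbd : |∫ y, (L ^ 2 + y ^ 2) * (a * V y * u₁ y * φ y)| ≤ |a| * (P * sD) * (sU1 * sW) := by
    calc |∫ y, (L ^ 2 + y ^ 2) * (a * V y * u₁ y * φ y)| ≤ ∫ y, |(L ^ 2 + y ^ 2) * (a * V y * u₁ y * φ y)| :=
          abs_integral_le_integral_abs
      _ ≤ ∫ y, |a| * (P * sD) * ((L ^ 2 + y ^ 2) * |u₁ y * φ y|) := integral_mono hAi.abs (hi1.const_mul _) hApt
      _ = |a| * (P * sD) * ∫ y, (L ^ 2 + y ^ 2) * |u₁ y * φ y| := integral_const_mul _ _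
      _ ≤ |a| * (P * sD) * (sU1 * sW) := mul_le_mul_of_nonneg_left hcs1 (mul_nonneg (abs_nonneg a) hCV0)
  -- term 2: B y = w·(H·u·φ)
  have hBm : AEStronglyMeasurable (fun y => (L ^ 2 + y ^ 2) * (H y * u y * φ y)) volume :=
    hwm.mul ((hHm.mul huc.aestronglyMeasurable).mul hφm)
  have hBpt : ∀ y, |(L ^ 2 + y ^ 2) * (H y * u y * φ y)| ≤ Real.sqrt 2 / L * sEU * ((L ^ 2 + y ^ 2) * |H y * φ y|) := by
    intro y
    have hw : 0 ≤ L ^ 2 + y ^ 2 := by positivity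
    rw [abs_mul, abs_of_nonneg hw, show H y * u y * φ y = u y * (H y * φ y) by ring, abs_mul]
    have h2 : 0 ≤ |H y * φ y| := abs_nonneg _
    nlinarith [mul_le_mul_of_nonneg_right (hU y) (mul_nonneg hw h2)]
  have hBi : Integrable (fun y => (L ^ 2 + y ^ 2) * (H y * u y * φ y)) :=
    (hi2.const_mul (Real.sqrt 2 / L * sEU)).mono' hBm (Eventually.of_forall fun y => by rw [Real.norm_eq_abs]; exact hBpt y)
  have hBbd : |∫ y, (L ^ 2 + y ^ 2) * (H y * u y * φ y)| ≤ Real.sqrt 2 / L * sEU * (sD * sW) := by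
    calc |∫ y, (L ^ 2 + y ^ 2) * (H y * u y * φ y)| ≤ ∫ y, |(L ^ 2 + y ^ 2) * (H y * u y * φ y)| :=
          abs_integral_le_integral_abs
      _ ≤ ∫ y, Real.sqrt 2 / L * sEU * ((L ^ 2 + y ^ 2) * |H y * φ y|) := integral_mono hBi.abs (hi2.const_mul _) hBpt
      _ = Real.sqrt 2 / L * sEU * ∫ y, (L ^ 2 + y ^ 2) * |H y * φ y| := integral_const_mul _ _
      _ ≤ Real.sqrt 2 / L * sEU * (sD * sW) := by
          refine mul_le_mul_of_nonneg_left ?_ hCU0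
          rw [← hsH]; exact hcs2
  -- the pairing integrand is `A − B`
  have hsplit : (fun y => (L ^ 2 + y ^ 2) * ((a * V y * u₁ y - H y * u y) * φ y))
      = fun y => (L ^ 2 + y ^ 2) * (a * V y * u₁ y * φ y) - (L ^ 2 + y ^ 2) * (H y * u y * φ y) := by
    funext y; ring
  refine ⟨by rw [hsplit]; exact hAi.sub hBi, ?_⟩
  rw [hsplit, integral_sub hAi hBi]
  -- numeric assembly
  have hA' : |∫ y, (L ^ 2 + y ^ 2) * (a * V y * u₁ y * φ y)| ≤ 2 * |a| * P * sED * sEU * sW := by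
    calc |∫ y, (L ^ 2 + y ^ 2) * (a * V y * u₁ y * φ y)| ≤ |a| * (P * sD) * (sU1 * sW) := hAbd
      _ ≤ |a| * (P * (2 * sED)) * (sEU * sW) := by gcongr
      _ = 2 * |a| * P * sED * sEU * sW := by ring
  have hB' : |∫ y, (L ^ 2 + y ^ 2) * (H y * u y * φ y)| ≤ 2 * (Real.sqrt 2 / L) * sED * sEU * sW := by
    calc |∫ y, (L ^ 2 + y ^ 2) * (H y * u y * φ y)| ≤ Real.sqrt 2 / L * sEU * (sD * sW) := hBbd
      _ ≤ Real.sqrt 2 / L * sEU * ((2 * sED) * sW) := by gcongr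
      _ = 2 * (Real.sqrt 2 / L) * sED * sEU * sW := by ring
  have e : (2 * |a| * P + 2 * Real.sqrt 2 / L) * sED * sEU * sW
      = 2 * |a| * P * sED * sEU * sW + 2 * (Real.sqrt 2 / L) * sED * sEU * sW := by ring
  rw [e]
  exact (abs_sub _ _).trans (add_le_add hA' hB')

/-! ### §4 The even Lipschitz bound at function level and the registered literal -/

/-- **The even linearisation difference, both terms.** For an EVEN zero-mass `H¹`-type `δ` (the perturbation, `δ ∈ E⁺₀`), an ODD `H¹`-type `u`
(a difference of two odd profiles `Ω₁ − Ω₂ ∈ E`) and a test `φ` in the energy class (`∫w(φ₁² + ¼φ²)` finite through `∫wφ²`, `∫wφ₁²`):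
`(DG⁺(Ω₁) − DG⁺(Ω₂))δ = a·(𝒰⁺δ·u′ + 𝒰u·δ′) − (Hδ·u + Hu·δ) = Q⁺(δ,u) + Q(u,δ)`, and
`|∫ w·[(a·𝒰⁺δ·u₁ − Hδ·u) + (a·𝒰u·δ₁ − Hu·δ)]·φ| ≤ 2·2·(2√2/L + 2|a|(π/(4L))^{1/2})·‖δ‖_E·‖u‖_E·‖φ‖_E`
(`abs_pairing_quadratic_even_le` + the odd `abs_pairing_quadratic_le` + `‖φ‖_w ≤ 2‖φ‖_E`).  The constant `8√2/L + 8|a|(π/(4L))^{1/2}` is the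
function-level even Lipschitz constant; MODEL frame bookkeeping. [folklore] -/
theorem abs_pairing_linearisation_diff_even_le {δ δ₁ u u₁ φ φ₁ : ℝ → ℝ} {L a : ℝ} (hL : 0 < L)
    (hδ : ∀ x, δ x = δ 0 + ∫ s in (0 : ℝ)..x, δ₁ s) (heven : ∀ y, δ (-y) = δ y) (hδ₁m : AEStronglyMeasurable δ₁ volume)
    (hwδ : Integrable fun y => (L ^ 2 + y ^ 2) * δ y ^ 2) (hwδ₁ : Integrable fun y => (L ^ 2 + y ^ 2) * δ₁ y ^ 2)
    (hm : ∫ y, δ y = 0)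
    (hu : ∀ x, u x = u 0 + ∫ s in (0 : ℝ)..x, u₁ s) (hu_odd : ∀ y, u (-y) = -u y) (hu₁m : AEStronglyMeasurable u₁ volume)
    (hwu : Integrable fun y => (L ^ 2 + y ^ 2) * u y ^ 2) (hwu₁ : Integrable fun y => (L ^ 2 + y ^ 2) * u₁ y ^ 2)
    (hφm : AEStronglyMeasurable φ volume) (hwφ : Integrable fun y => (L ^ 2 + y ^ 2) * φ y ^ 2)
    (hwφ₁ : Integrable fun y => (L ^ 2 + y ^ 2) * φ₁ y ^ 2) :
    |∫ y, (L ^ 2 + y ^ 2) * (((a * (∫ s in Iic y, hilbertTransform δ s) * u₁ y - hilbertTransform δ y * u y)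
        + (a * (∫ s in (0 : ℝ)..y, hilbertTransform u s) * δ₁ y - hilbertTransform u y * δ y)) * φ y)|
      ≤ 2 * 2 * (2 * Real.sqrt 2 / L + 2 * |a| * Real.sqrt (π / (4 * L)))
        * Real.sqrt (∫ y, (L ^ 2 + y ^ 2) * (δ₁ y ^ 2 + 1 / 4 * δ y ^ 2))
        * Real.sqrt (∫ y, (L ^ 2 + y ^ 2) * (u₁ y ^ 2 + 1 / 4 * u y ^ 2))
        * Real.sqrt (∫ y, (L ^ 2 + y ^ 2) * (φ₁ y ^ 2 + 1 / 4 * φ y ^ 2)) := by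
  obtain ⟨hI1, h1⟩ := abs_pairing_quadratic_even_le hL hδ heven hδ₁m hwδ hwδ₁ hm hu hu₁m hwu hwu₁ hφm hwφ
  obtain ⟨hI2, h2⟩ := abs_pairing_quadratic_le (a := a) hL hu hu_odd hu₁m hwu hwu₁ hδ hδ₁m hwδ hwδ₁ hφm hwφ
  obtain ⟨hφle, -⟩ := sqrt_weightedSq_le_energy hwφ hwφ₁
  set sED : ℝ := Real.sqrt (∫ y, (L ^ 2 + y ^ 2) * (δ₁ y ^ 2 + 1 / 4 * δ y ^ 2))
  set sEU : ℝ := Real.sqrt (∫ y, (L ^ 2 + y ^ 2) * (u₁ y ^ 2 + 1 / 4 * u y ^ 2))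
  set sW : ℝ := Real.sqrt (∫ y, (L ^ 2 + y ^ 2) * φ y ^ 2)
  set sEW : ℝ := Real.sqrt (∫ y, (L ^ 2 + y ^ 2) * (φ₁ y ^ 2 + 1 / 4 * φ y ^ 2))
  set K : ℝ := 2 * |a| * Real.sqrt (π / (4 * L)) + 2 * Real.sqrt 2 / L
  have hK0 : 0 ≤ K := by positivity
  have hsum : (fun y => (L ^ 2 + y ^ 2) * (((a * (∫ s in Iic y, hilbertTransform δ s) * u₁ y - hilbertTransform δ y * u y)
        + (a * (∫ s in (0 : ℝ)..y, hilbertTransform u s) * δ₁ y - hilbertTransform u y * δ y)) * φ y))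
      = fun y => (L ^ 2 + y ^ 2) * ((a * (∫ s in Iic y, hilbertTransform δ s) * u₁ y - hilbertTransform δ y * u y) * φ y)
        + (L ^ 2 + y ^ 2) * ((a * (∫ s in (0 : ℝ)..y, hilbertTransform u s) * δ₁ y - hilbertTransform u y * δ y) * φ y) := by
    funext y; ring
  rw [hsum, integral_add hI1 hI2]
  have hcomm : K * sEU * sED * sW = K * sED * sEU * sW := by ring
  rw [hcomm] at h2
  have htot : |(∫ y, (L ^ 2 + y ^ 2) * ((a * (∫ s in Iic y, hilbertTransform δ s) * u₁ y - hilbertTransform δ y * u y) * φ y))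
      + ∫ y, (L ^ 2 + y ^ 2) * ((a * (∫ s in (0 : ℝ)..y, hilbertTransform u s) * δ₁ y - hilbertTransform u y * δ y) * φ y)|
      ≤ 2 * K * sED * sEU * sW := by
    calc _ ≤ K * sED * sEU * sW + K * sED * sEU * sW := (abs_add_le _ _).trans (add_le_add h1 h2)
      _ = 2 * K * sED * sEU * sW := by ring
  have hKK : 0 ≤ 2 * K * sED * sEU := by positivity
  calc _ ≤ 2 * K * sED * sEU * sW := htot
    _ ≤ 2 * K * sED * sEU * (2 * sEW) := mul_le_mul_of_nonneg_left hφle hKK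
    _ = 2 * 2 * (2 * Real.sqrt 2 / L + 2 * |a| * Real.sqrt (π / (4 * L))) * sED * sEU * sEW := by ring

/-- **The registered even literal dominates the function-level constant at the certificate's point**: with `L = 8`, `a = 1/5`,
`2·2·(2√2/8 + 2·(1/5)·(π/32)^{1/2}) = √2 + (4/5)(π/32)^{1/2} ≤ 2.01937 = L⁺_lip` (DESIGN (D3); indeed `≤ 1.9156`, using `√2 < 1.4143`,
`π < 3.1416`). So `CertificateViscousSheetRSpectrumEven.LlipE` is an UPPER bound of the even trilinear constant. MODEL frame bookkeeping. [folklore] -/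
theorem evenLipschitzConstant_le_LlipE :
    2 * 2 * (2 * Real.sqrt 2 / 8 + 2 * |(1 / 5 : ℝ)| * Real.sqrt (π / (4 * 8))) ≤ (201937 : ℝ) / 100000 := by
  have h2 : Real.sqrt 2 < 1.4143 := by
    rw [Real.sqrt_lt' (by norm_num)]; norm_num
  have hπ : π / (4 * 8) < 0.0982 := by
    have := Real.pi_lt_d4; rw [div_lt_iff₀ (by norm_num)]; linarith
  have hs : Real.sqrt (π / (4 * 8)) < 0.3134 := by
    rw [Real.sqrt_lt' (by norm_num)]
    exact hπ.trans (by norm_num)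
  rw [abs_of_pos (by norm_num : (0 : ℝ) < 1 / 5)]
  nlinarith [Real.sqrt_nonneg 2, Real.sqrt_nonneg (π / (4 * 8))]

end SheetREvenEnergyClass
end Summit.NavierStokesRegularity.OSWSelfSimilar

end
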